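import Summits.Ventures.PercRepro0.CritFragile
import Summits.Ventures.PercRepro0.Coupling
import Summits.Ventures.PercRepro0.MidClose
import Summits.Ventures.PercRepro0.Events
import Summits.Ventures.PercRepro0.SubdivisionLaw

/-! # R_MID-13 · CRIT-FRAGILE, Corollary C in Lean (p6): no bounded subdivision of `ℤ²` inside the
critical configuration

Kernel twin of proofs/CRITFRAGILE-plan-1-v1.md §4 (Definition + Corollary C), lead RULING Z:
for `d ≥ 2` and `P_{p_c(d)}`-a.e. configuration `G`, for every `K ≥ 1` there is no `K`-subdivision of
the planar lattice `𝕃²` inside `G` (`noSubdivision`) — in particular no subgraph isomorphic to `ℤ²`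
(`noCopy`, the `K = 1` instance).

Proof (the paper's, with one proof choice): for a `K`-subdivision `(ι, π)` with bond set
`F = ⋃ π e ⊆ G`, Bernoulli(`q`) percolation on `F` (the threshold configuration `ω` of the uniform
family) contains the block configuration `η = {e : π e ⊆ ω}`, whose law dominates `setBer(𝔼², q^K)`
on increasing events (`SubdivisionLaw`, in place of the paper's uniformisation
`W_e = (max_{b ∈ π_e} V_b)^{ℓ_e}`); an infinite `η`-cluster of `𝕃²` maps into an infinite `ω`-cluster
of `𝕃^d` through the injective `ι` and the connections `π e` (the paper's step (4)); so
`setBer(F, q)(E_∞) ≥ P^{(2)}_{q^K}(0 ↔ ∞) = θ_2(q^K)`, which is positive at `q^K = (1 + p_c(2))/2 > p_c(2)`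
(`MidClose.pc_lt_one`, `theta_pos_of_pc_lt'`) — against Theorem CRIT-FRAGILE (`critFragile`) at
`F ⊆ G`, `q < 1`.
Inputs: CritFragile (p6), Coupling (p5), MidClose (p3), Events (p5), SubdivisionLaw (p6), on Defs verbatim.
-/

namespace Summit.Ventures.PercRepro0.CritFragileCor

open MeasureTheory ProbabilityTheory unitInterval Set
open scoped ENNReal
open Summit.Ventures.PercRepro0.Defs
open Summit.Ventures.PercRepro0.CritFragile
open Summit.Ventures.PercRepro0.SubdivisionLaw

variable {d : ℕ}

/-- DEFINITION (paper §4): a `K`-SUBDIVISION OF `𝕃²` IN `G ⊆ 𝔼^d` is a pair `(ι, π)` with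
`ι : ℤ² → ℤ^d` injective and `π` assigning to every bond `e` of `𝕃²` a set `π e ⊆ G` of bonds with
`1 ≤ |π e| ≤ K`, such that `ι u ↔ ι v` in the configuration `π e` for `e = {u, v}` and the sets
`π e`, `e ∈ 𝔼²`, are pairwise disjoint. -/
def IsSubdivision (d K : ℕ) (G : Config d) (ι : Vertex 2 → Vertex d)
    (π : Sym2 (Vertex 2) → Finset (Sym2 (Vertex d))) : Prop :=
  Function.Injective ι ∧
  (∀ e ∈ bonds 2, (π e : Set (Sym2 (Vertex d))) ⊆ G ∧ 1 ≤ (π e).card ∧ (π e).card ≤ K) ∧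
  (∀ u v : Vertex 2, (lattice 2).Adj u v → Conn d (π s(u, v) : Set (Sym2 (Vertex d))) (ι u) (ι v)) ∧
  ∀ e ∈ bonds 2, ∀ e' ∈ bonds 2, e ≠ e' → Disjoint (π e) (π e')

/-- The bond set `F = ⋃_{e ∈ 𝔼²} π e` of a subdivision. -/
def subdivBonds (π : Sym2 (Vertex 2) → Finset (Sym2 (Vertex d))) : Config d :=
  ⋃ e ∈ bonds 2, (π e : Set (Sym2 (Vertex d)))

/-- The bond set of a subdivision of `𝕃²` in `G` lies in `G`. -/
theorem subdivBonds_subset {K : ℕ} {G : Config d} {ι : Vertex 2 → Vertex d}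
    {π : Sym2 (Vertex 2) → Finset (Sym2 (Vertex d))} (h : IsSubdivision d K G ι π) :
    subdivBonds π ⊆ G :=
  iUnion₂_subset fun e he => (h.2.1 e he).1

/-- STEP (4) of the paper, connections: if every block `π e` of a bond `e` open in `η` is open in
`ω`, then an `η`-connection `u ↔ v` in `𝕃²` gives an `ω`-connection `ι u ↔ ι v` in `𝕃^d`. -/
theorem conn_of_conn_blocks {K : ℕ} {G : Config d} {ι : Vertex 2 → Vertex d}
    {π : Sym2 (Vertex 2) → Finset (Sym2 (Vertex d))} (h : IsSubdivision d K G ι π) {η : Config 2}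
    {ω : Config d} (hηω : ∀ e ∈ bonds 2, e ∈ η → (π e : Set (Sym2 (Vertex d))) ⊆ ω)
    {u v : Vertex 2} (huv : Conn 2 η u v) : Conn d ω (ι u) (ι v) := by
  obtain ⟨w⟩ := huv
  induction w with
  | nil => exact SimpleGraph.Reachable.refl _
  | @cons x y z hadj _ ih =>
    rw [openGraph, SimpleGraph.fromEdgeSet_adj] at hadj
    have hxy : (lattice 2).Adj x y := (SimpleGraph.mem_edgeSet _).1 hadj.1.2
    have h1 : Conn d ω (ι x) (ι y) :=
      conn_mono (hηω _ hadj.1.2 hadj.1.1) (h.2.2.1 x y hxy)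
    exact h1.trans ih

/-- STEP (4) of the paper, clusters: an infinite `η`-cluster in `𝕃²` gives an infinite `ω`-cluster
in `𝕃^d` (the image of the cluster under the injective `ι`). -/
theorem existsInfCluster_of_blocks {K : ℕ} {G : Config d} {ι : Vertex 2 → Vertex d}
    {π : Sym2 (Vertex 2) → Finset (Sym2 (Vertex d))} (h : IsSubdivision d K G ι π) {η : Config 2}
    {ω : Config d} (hηω : ∀ e ∈ bonds 2, e ∈ η → (π e : Set (Sym2 (Vertex d))) ⊆ ω)
    (hη : η ∈ existsInfCluster 2) : ω ∈ existsInfCluster d := by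
  obtain ⟨u, hu⟩ := hη
  refine ⟨ι u, ?_⟩
  have himg : ι '' cluster 2 η u ⊆ cluster d ω (ι u) := by
    rintro _ ⟨v, hv, rfl⟩
    exact conn_of_conn_blocks h hηω hv
  exact ((Set.infinite_image_iff h.1.injOn).2 hu).mono himg

/-- The blocks of a subdivision as a family indexed by ALL of `Sym2 (Vertex 2)` (empty off the bonds). -/
noncomputable def blocks (π : Sym2 (Vertex 2) → Finset (Sym2 (Vertex d))) (e : Sym2 (Vertex 2)) :
    Finset (Sym2 (Vertex d)) :=
  by classical exact if e ∈ bonds 2 then π e else ∅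

/-- On a bond of `𝕃²` the block is `π e`. -/
theorem blocks_of_mem (π : Sym2 (Vertex 2) → Finset (Sym2 (Vertex d))) {e : Sym2 (Vertex 2)}
    (he : e ∈ bonds 2) : blocks π e = π e := by
  simp [blocks, he]

/-- Off the bonds of `𝕃²` the block is empty. -/
theorem blocks_of_not_mem (π : Sym2 (Vertex 2) → Finset (Sym2 (Vertex d))) {e : Sym2 (Vertex 2)}
    (he : e ∉ bonds 2) : blocks π e = ∅ := by
  simp [blocks, he]

/-- The blocks of a subdivision are pairwise disjoint (as a family over all of `Sym2 (Vertex 2)`). -/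
theorem blocks_pairwise_disjoint {K : ℕ} {G : Config d} {ι : Vertex 2 → Vertex d}
    {π : Sym2 (Vertex 2) → Finset (Sym2 (Vertex d))} (h : IsSubdivision d K G ι π) :
    Pairwise fun e e' => Disjoint (blocks π e) (blocks π e') := by
  intro e e' hee
  by_cases he : e ∈ bonds 2
  · by_cases he' : e' ∈ bonds 2
    · rw [blocks_of_mem π he, blocks_of_mem π he']
      exact h.2.2.2 e he e' he' hee
    · rw [blocks_of_not_mem π he']
      exact Finset.disjoint_empty_right _
  · rw [blocks_of_not_mem π he]
    exact Finset.disjoint_empty_left _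

/-- The blocks of a `K`-subdivision have at most `K` bonds on the bonds of `𝕃²`. -/
theorem blocks_card_le {K : ℕ} {G : Config d} {ι : Vertex 2 → Vertex d}
    {π : Sym2 (Vertex 2) → Finset (Sym2 (Vertex d))} (h : IsSubdivision d K G ι π) :
    ∀ e ∈ bonds 2, (blocks π e).card ≤ K := by
  intro e he
  rw [blocks_of_mem π he]
  exact (h.2.1 e he).2.2

/-- The block configuration of the uniform family on the bonds of `𝕃^d` opens every block of a bond
it contains inside the threshold configuration `ω = {b ∈ F : U b ≤ q}`. -/
theorem blocks_subset_threshold (π : Sym2 (Vertex 2) → Finset (Sym2 (Vertex d))) (q : I)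
    (U : Sym2 (Vertex d) → ℝ) :
    ∀ e ∈ bonds 2, e ∈ blockConfig (bonds 2) (blocks π) q U →
      (π e : Set (Sym2 (Vertex d))) ⊆ threshold (subdivBonds π) q U := by
  intro e he heU b hb
  have hbU : U b ≤ (q : ℝ) := by
    have := heU.2 b
    rw [blocks_of_mem π he] at this
    exact this hb
  refine ⟨?_, hbU⟩
  exact Set.mem_iUnion₂.2 ⟨e, he, hb⟩

/-- THE QUANTITATIVE LEMMA (the paper's chain `P^F_q(E_∞) ≥ P^{(2)}_{q^K}(E^{(2)}_∞) ≥ θ_2(q^K)`):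
for a `K`-subdivision `(ι, π)` of `𝕃²` in `G` with bond set `F = ⋃ π e`, Bernoulli(`q`) percolation
on `F` has an infinite cluster with probability at least `P_{q^K}(0 ↔ ∞)` in `𝕃²`. -/
theorem P_percolates_two_le_setBernoulli {K : ℕ} {G : Config d} {ι : Vertex 2 → Vertex d}
    {π : Sym2 (Vertex 2) → Finset (Sym2 (Vertex d))} (h : IsSubdivision d K G ι π) (q : I) :
    P 2 (q ^ K) (percolates 2) ≤ setBernoulli (subdivBonds π) q (existsInfCluster d) := by
  calc P 2 (q ^ K) (percolates 2)
      ≤ P 2 (q ^ K) (existsInfCluster 2) := measure_mono fun ω hω => ⟨0, hω⟩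
    _ = setBernoulli (bonds 2) (q ^ K) (existsInfCluster 2) := rfl
    _ ≤ ((Measure.infinitePi fun _ : Sym2 (Vertex d) => unif).map
          (blockConfig (bonds 2) (blocks π) q)) (existsInfCluster 2) :=
        setBernoulli_pow_le_map_blockConfig (bonds 2) (blocks_pairwise_disjoint h) q
          (blocks_card_le h) isUpperSet_existsInfCluster measurableSet_existsInfCluster
    _ = (Measure.infinitePi fun _ : Sym2 (Vertex d) => unif)
          (blockConfig (bonds 2) (blocks π) q ⁻¹' existsInfCluster 2) := by
        rw [Measure.map_apply (measurable_blockConfig _ _ _) measurableSet_existsInfCluster]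
    _ ≤ (Measure.infinitePi fun _ : Sym2 (Vertex d) => unif)
          (threshold (subdivBonds π) q ⁻¹' existsInfCluster d) :=
        measure_mono fun U hU => existsInfCluster_of_blocks h (blocks_subset_threshold π q U) hU
    _ = setBernoulli (subdivBonds π) q (existsInfCluster d) := by
        rw [← map_threshold_eq_setBernoulli (subdivBonds π) q,
          Measure.map_apply (measurable_threshold _ _) measurableSet_existsInfCluster]

/-- COROLLARY C, deterministic form: a configuration `G` with the conclusion of Theorem CRIT-FRAGILE
(`setBer(F, q)(E_∞) = 0` for every `F ⊆ G` and `q < 1`) contains no `K`-subdivision of `𝕃²`, for any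
`K ≥ 1` (no hypothesis on `d` is needed here; the paper states it for `d ≥ 2`): with `t = (1 + p_c(2))/2 ∈ (p_c(2), 1)` and `q = t^{1/K} < 1`, the quantitative
lemma gives `setBer(F, q)(E_∞) ≥ θ_2(t) > 0`. -/
theorem not_isSubdivision_of_fragile {G : Config d}
    (hG : ∀ F ⊆ G, ∀ q : I, (q : ℝ) < 1 → setBernoulli F q (existsInfCluster d) = 0) {K : ℕ}
    (hK : 1 ≤ K) (ι : Vertex 2 → Vertex d) (π : Sym2 (Vertex 2) → Finset (Sym2 (Vertex d))) :
    ¬ IsSubdivision d K G ι π := by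
  intro h
  have hpc1 : pc 2 < 1 := MidClose.pc_lt_one le_rfl
  have hpc0 : 0 ≤ pc 2 := (pc_mem_Icc one_le_two).1
  set t : ℝ := (1 + pc 2) / 2 with ht
  have ht0 : 0 ≤ t := by rw [ht]; linarith
  have ht1 : t < 1 := by rw [ht]; linarith
  have htpc : pc 2 < t := by rw [ht]; linarith
  set r : ℝ := t ^ ((K : ℝ)⁻¹) with hr
  have hr0 : 0 ≤ r := Real.rpow_nonneg ht0 _
  have hr1 : r < 1 := Real.rpow_lt_one ht0 ht1 (inv_pos.2 (Nat.cast_pos.2 (by omega)))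
  let q : I := ⟨r, hr0, hr1.le⟩
  have hqK : ((q ^ K : I) : ℝ) = t := by
    rw [Set.Icc.coe_pow]
    exact Real.rpow_inv_natCast_pow ht0 (by omega)
  have hθ : 0 < theta 2 t := theta_pos_of_pc_lt' one_le_two htpc ht1.le
  have hclamp : clamp t = q ^ K := by
    apply Subtype.ext
    rw [hqK, clamp, Set.projIcc_of_mem zero_le_one ⟨ht0, ht1.le⟩]
  have hpos : P 2 (q ^ K) (percolates 2) ≠ 0 := by
    intro h0
    rw [theta, thetaI, hclamp, h0, ENNReal.toReal_zero] at hθ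
    exact lt_irrefl _ hθ
  have hle := P_percolates_two_le_setBernoulli h q
  rw [hG _ (subdivBonds_subset h) q hr1] at hle
  exact hpos (le_antisymm hle bot_le)

/-- COROLLARY C (R_MID-13, paper §4): for `d ≥ 2` and `P_{p_c(d)}`-a.e. configuration `G`, for
every `K ≥ 1` there is no `K`-subdivision of `𝕃²` in `G` — the critical configuration contains no
bounded-length subdivision of `ℤ²` (the null set is that of Theorem CRIT-FRAGILE). -/
theorem noSubdivision (hd : 2 ≤ d) :
    ∀ᵐ G ∂(P d (clamp (pc d))), ∀ K : ℕ, 1 ≤ K → ∀ (ι : Vertex 2 → Vertex d)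
      (π : Sym2 (Vertex 2) → Finset (Sym2 (Vertex d))), ¬ IsSubdivision d K G ι π := by
  filter_upwards [critFragile (show 1 ≤ d by omega)] with G hG
  intro K hK ι π
  exact not_isSubdivision_of_fragile hG hK ι π

/-- An injective graph homomorphism of `𝕃²` into the open graph of `G` is a `1`-subdivision
(`π e = {ι(e)}`). -/
theorem isSubdivision_of_hom {G : Config d} {ι : Vertex 2 → Vertex d} (hι : Function.Injective ι)
    (hhom : ∀ u v : Vertex 2, (lattice 2).Adj u v → (openGraph d G).Adj (ι u) (ι v)) :
    IsSubdivision d 1 G ι fun e => {Sym2.map ι e} := by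
  refine ⟨hι, ?_, ?_, ?_⟩
  · intro e
    induction e using Sym2.ind with
    | h u v =>
      intro he
      have hadj := hhom u v ((SimpleGraph.mem_edgeSet _).1 he)
      rw [openGraph, SimpleGraph.fromEdgeSet_adj] at hadj
      refine ⟨?_, by simp, by simp⟩
      intro b hb
      rw [Finset.coe_singleton, Set.mem_singleton_iff, Sym2.map_mk] at hb
      rw [hb]
      exact hadj.1.1
  · intro u v huv
    have hadj := hhom u v huv
    rw [openGraph, SimpleGraph.fromEdgeSet_adj] at hadj
    refine SimpleGraph.Adj.reachable ?_
    rw [openGraph, SimpleGraph.fromEdgeSet_adj]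
    refine ⟨⟨?_, hadj.1.2⟩, hadj.2⟩
    rw [Finset.coe_singleton, Set.mem_singleton_iff, Sym2.map_mk]
  · intro e _ e' _ hee
    exact Finset.disjoint_singleton.2 fun h => hee (Sym2.map.injective hι h)

/-- The `K = 1` instance («in particular»): `P_{p_c(d)}`-a.s. there is no injective graph
homomorphism of `𝕃²` into the open graph of the configuration — no subgraph isomorphic to `ℤ²`. -/
theorem noCopy (hd : 2 ≤ d) :
    ∀ᵐ G ∂(P d (clamp (pc d))), ∀ ι : Vertex 2 → Vertex d, Function.Injective ι →
      ¬ ∀ u v : Vertex 2, (lattice 2).Adj u v → (openGraph d G).Adj (ι u) (ι v) := by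
  filter_upwards [noSubdivision hd] with G hG
  intro ι hι hhom
  exact hG 1 le_rfl ι _ (isSubdivision_of_hom hι hhom)

end Summit.Ventures.PercRepro0.CritFragileCor
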